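import Summits.CriticalPhenomena.SAWScalingLimit.Theses.SAWDefectDecoherence
import Summits.CriticalPhenomena.SAWScalingLimit.Theorems.SAWDefectDecoherenceBoundaryClosureRLocalL1Necessity
import Summits.CriticalPhenomena.SAWScalingLimit.Theorems.SAWDefectDecoherenceBoundaryClosureRLocalL1Normaliser
import HarnessLib

/-!
# `BoundaryClosureR`, line `pick-half-plane` (r15): the model input `LocalL1Root` is NECESSARY
(crux stmt-CriticalPhenomena-14004, stub `stub_localL1Root_necessity`; registered sub-goal
`localL1Root_of_target`)

The r15 skeleton reduces the crux `BoundaryClosureR := DefectDecoherence → MassRatio →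
HexObservableLimitR` to two model inputs; the first, `LocalL1Root`, is the local `L¹` law of the
`b`-normalised critical parafermionic observable `F_δ = F(a δ, ·, x_c, 5/8)` of an admissible family
`Λ δ` (Dobrushin domain flat near the normaliser `D.pt 1`, admissible discretisation, normaliser
`b δ → D.pt 1`) whose root `a δ → D.pt 0` is pinned flat at `D.pt 0`: on every compact `K` of the
carrier, `δ² Σ_{z ∈ Ω_δ, δ·mid z ∈ K} ‖F_δ(z)‖ ≤ C_K ‖F_δ(b δ)‖` eventually as `δ → 0⁺`.

THEOREM (`localL1Root_of_target`, the skeleton's `FrameDatumExists → HexObservableLimitR →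
LocalL1Root` with the two line-local definitions UNFOLDED verbatim): given the existence of an
admissible conformal datum `(Φ, L, L_b)` for every Dobrushin domain flat near `D.pt 1` (the
skeleton's `FrameDatumExists`, taken here as a HYPOTHESIS; it is landed separately as
`frameDatum_exists`), the target `HexObservableLimitR` implies the local `L¹` law at its root.

Proof.  (1) The datum hypothesis gives `Φ, L, L_b` with the five frame facts.  (2) Repackage the
two bundles for the target exactly as in the landed identification of weak limits
(`weakLimit_eq_of_hexObservableLimitR`, p83707): common pin radius `min ρ r₀`, flatness on the two
smaller balls, pins `![m₀, m]`, the target's eventual clause as the conjunction of the two given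
ones.  (3) Hence for every continuous compactly supported `ψ` with `tsupport ψ ⊆ Ω` the normalised
functional `N_δ(ψ) = δ² (Σ_e ψ(δ·mid e) F_δ(e)) / F_δ(b δ)` CONVERGES along `𝓝[>] 0`, so `‖N_δ(ψ)‖`
is eventually bounded (by `‖limit‖ + 1`).  (4) The normaliser `F_δ(b δ)` is eventually non-zero
(winding rigidity, `LocalL1.eventually_normaliser_ne_zero_of_bundles`).  (5) Banach–Steinhaus on
`ℂ →ᵇ ℂ` in the landed form `LocalL1.localL1Bound_of_eventually_bounded` (p88459) concludes.
No new definitions; no model input is used.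
-/

noncomputable section

open scoped Topology
open Filter Set MeasureTheory
open Literature.Probability.LatticeModels Literature.Probability.RandomPlanarGeometry
open Literature.Probability.RandomPlanarGeometry.SAW
open Summit.CriticalPhenomena.SAWScalingLimit.Theses.SAWDefectDecoherence

namespace Summit.CriticalPhenomena.SAWScalingLimit.Theorems.PickHalfPlane.LocalL1

/-- **Necessity of `LocalL1Root`** (registered sub-goal `localL1Root_of_target` of the stub
`stub_localL1Root_necessity`, r15): if every Dobrushin domain flat near `D.pt 1` carries an
admissible conformal datum `(Φ, L, L_b)` (the skeleton's `FrameDatumExists`, a hypothesis here),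
then the target `HexObservableLimitR` implies the local `L¹` law of the `b`-normalised critical
observable at the target's root: for every admissible family (`AdmissibleFamily D ρ Λ m b`
unfolded) and every root family pinned flat at `D.pt 0` (`PinnedFlatRoot D Λ b (D.pt 0) a r₀ m₀`
unfolded), on every compact `K ⊆ D.carrier`,
`∃ C, ∀ᶠ δ, δ² Σ_{z ∈ Ω_δ, δ·mid z ∈ K} ‖F_δ(z)‖ ≤ C ‖F_δ(b δ)‖`.  The target (fed with the common
pin radius `min ρ r₀` and pins `![m₀, m]`) makes every normalised functional `N_δ(ψ)` converge,
hence eventually bounded in norm; the normaliser is eventually non-zero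
(`eventually_normaliser_ne_zero_of_bundles`); Banach–Steinhaus
(`localL1Bound_of_eventually_bounded`) gives the law. [folklore] -/
theorem localL1Root_of_target :
    (∀ (D : DobrushinDomain) (ρ : ℝ), 0 < ρ →
    D.carrier ∩ Metric.ball (D.pt 1) ρ = {z : ℂ | (D.pt 1).im < z.im} ∩ Metric.ball (D.pt 1) ρ →
    ∃ (Φ : ConformalEquiv D.carrier UpperHalfPlane.upperHalfPlaneSet) (L : ℂ → ℂ) (Lb : ℂ),
      Tendsto (fun z => ‖Φ z‖) (𝓝[D.carrier] (D.pt 0)) atTop ∧ Φ.HasBoundaryValue (D.pt 1) 0 ∧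
      ContinuousOn L D.carrier ∧ (∀ z ∈ D.carrier, Complex.exp (L z) = deriv Φ z) ∧
      Tendsto L (𝓝[D.carrier] (D.pt 1)) (𝓝 Lb)) →
    HexObservableLimitR →
    ∀ (D : DobrushinDomain) (ρ : ℝ) (Λ : ℝ → Finset HexVertex) (m : ℝ → ℤ) (b : ℝ → Sym2 HexVertex),
      (0 < ρ ∧
        D.carrier ∩ Metric.ball (D.pt 1) ρ = {z : ℂ | (D.pt 1).im < z.im} ∩ Metric.ball (D.pt 1) ρ ∧
        (∀ᶠ δ : ℝ in 𝓝[>] 0, hexDomainSimplyConnected (Λ δ) ∧ b δ ∈ hexDomainBoundary (Λ δ) ∧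
            (hexGraph.induce ((Λ δ : Finset HexVertex) : Set HexVertex)).Preconnected ∧
            (∀ v ∈ Λ δ, (δ : ℂ) * hexCenter v ∈ D.carrier) ∧
            (∀ v : HexVertex, (δ : ℂ) * hexCenter v ∈ Metric.ball (D.pt 1) ρ →
              (v ∈ Λ δ ↔ m δ ≤ v.1 1))) ∧
        (∀ K : Set ℂ, IsCompact K → K ⊆ D.carrier →
            ∀ᶠ δ : ℝ in 𝓝[>] 0, ∀ v : HexVertex, (δ : ℂ) * hexCenter v ∈ K → v ∈ Λ δ) ∧
        Tendsto (fun δ : ℝ => (δ : ℂ) * hexMidpoint (b δ)) (𝓝[>] 0) (𝓝 (D.pt 1))) →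
    ∀ (a : ℝ → Sym2 HexVertex) (r₀ : ℝ) (m₀ : ℝ → ℤ),
      (0 < r₀ ∧
        D.carrier ∩ Metric.ball (D.pt 0) r₀ = {z : ℂ | (D.pt 0).im < z.im} ∩ Metric.ball (D.pt 0) r₀ ∧
        (∀ᶠ δ : ℝ in 𝓝[>] 0, a δ ∈ hexDomainBoundary (Λ δ) ∧
            Nonempty (HexMidEdgeSAW (Λ δ) (a δ) (b δ)) ∧
            (∀ v : HexVertex, (δ : ℂ) * hexCenter v ∈ Metric.ball (D.pt 0) r₀ →
              (v ∈ Λ δ ↔ m₀ δ ≤ v.1 1))) ∧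
        Tendsto (fun δ : ℝ => (δ : ℂ) * hexMidpoint (a δ)) (𝓝[>] 0) (𝓝 (D.pt 0))) →
    (∀ K : Set ℂ, IsCompact K → K ⊆ D.carrier → ∃ C : ℝ, ∀ᶠ δ : ℝ in 𝓝[>] 0,
      δ ^ 2 * (∑ᶠ z ∈ {z : Sym2 HexVertex | z ∈ hexDomainMidEdges (Λ δ) ∧
          (δ : ℂ) * hexMidpoint z ∈ K},
        ‖hexParafermionicObservable (Λ δ) (a δ) hexCriticalFugacity (5 / 8) z‖) ≤
      C * ‖hexParafermionicObservable (Λ δ) (a δ) hexCriticalFugacity (5 / 8) (b δ)‖) := by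
  rintro hFD ⟨c, -, hT⟩ D ρ Λ m b ⟨hρ, hflat1, hadm1, hexh, hb⟩ a r₀ m₀ ⟨hr₀, hflat0, hadm0, ha⟩
    K hK hKU
  -- (1) an admissible conformal datum of the domain, flat near `D.pt 1`
  obtain ⟨Φ, L, Lb, hΦ, hΦb, hL, hexpL, hLb⟩ := hFD D ρ hρ hflat1
  -- (2) repackage the two bundles for the target: common pin radius and the two row functions
  set ρ' : ℝ := min ρ r₀ with hρ'def
  have hρ' : 0 < ρ' := lt_min hρ hr₀
  set m' : Fin 2 → ℝ → ℤ := ![m₀, m] with hm'def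
  have hball0 : Metric.ball (D.pt 0) ρ' ⊆ Metric.ball (D.pt 0) r₀ :=
    Metric.ball_subset_ball (min_le_right _ _)
  have hball1 : Metric.ball (D.pt 1) ρ' ⊆ Metric.ball (D.pt 1) ρ :=
    Metric.ball_subset_ball (min_le_left _ _)
  have hflat : ∀ i : Fin 2, D.carrier ∩ Metric.ball (D.pt i) ρ' =
      {z : ℂ | (D.pt i).im < z.im} ∩ Metric.ball (D.pt i) ρ' := by
    refine Fin.forall_fin_two.2 ⟨?_, ?_⟩
    · ext w
      constructor
      · rintro ⟨hw, hw'⟩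
        have : w ∈ D.carrier ∩ Metric.ball (D.pt 0) r₀ := ⟨hw, hball0 hw'⟩
        rw [hflat0] at this
        exact ⟨this.1, hw'⟩
      · rintro ⟨hw, hw'⟩
        have : w ∈ {z : ℂ | (D.pt 0).im < z.im} ∩ Metric.ball (D.pt 0) r₀ := ⟨hw, hball0 hw'⟩
        rw [← hflat0] at this
        exact ⟨this.1, hw'⟩
    · ext w
      constructor
      · rintro ⟨hw, hw'⟩
        have : w ∈ D.carrier ∩ Metric.ball (D.pt 1) ρ := ⟨hw, hball1 hw'⟩
        rw [hflat1] at this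
        exact ⟨this.1, hw'⟩
      · rintro ⟨hw, hw'⟩
        have : w ∈ {z : ℂ | (D.pt 1).im < z.im} ∩ Metric.ball (D.pt 1) ρ := ⟨hw, hball1 hw'⟩
        rw [← hflat1] at this
        exact ⟨this.1, hw'⟩
  have hadm : ∀ᶠ δ : ℝ in 𝓝[>] 0, hexDomainSimplyConnected (Λ δ) ∧ a δ ∈ hexDomainBoundary (Λ δ) ∧
      b δ ∈ hexDomainBoundary (Λ δ) ∧ Nonempty (HexMidEdgeSAW (Λ δ) (a δ) (b δ)) ∧
      (hexGraph.induce ((Λ δ : Finset HexVertex) : Set HexVertex)).Preconnected ∧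
      (∀ v ∈ Λ δ, (δ : ℂ) * hexCenter v ∈ D.carrier) ∧
      (∀ i : Fin 2, ∀ v : HexVertex, (δ : ℂ) * hexCenter v ∈ Metric.ball (D.pt i) ρ' →
        (v ∈ Λ δ ↔ m' i δ ≤ v.1 1)) := by
    filter_upwards [hadm1, hadm0] with δ h1 h0
    refine ⟨h1.1, h0.1, h1.2.1, h0.2.1, h1.2.2.1, h1.2.2.2.1, Fin.forall_fin_two.2 ⟨?_, ?_⟩⟩
    · intro v hv
      exact h0.2.2 v (hball0 hv)
    · intro v hv
      exact h1.2.2.2.2 v (hball1 hv)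
  -- (3) every normalised functional converges by the target, hence is eventually bounded in norm
  have hN : ∀ ψ : ℂ → ℂ, Continuous ψ → HasCompactSupport ψ → tsupport ψ ⊆ D.carrier →
      ∃ M : ℝ, ∀ᶠ δ : ℝ in 𝓝[>] 0,
        ‖(δ : ℂ) ^ 2 * (∑ᶠ z ∈ hexDomainMidEdges (Λ δ), ψ ((δ : ℂ) * hexMidpoint z) *
            hexParafermionicObservable (Λ δ) (a δ) hexCriticalFugacity (5 / 8) z) /
          hexParafermionicObservable (Λ δ) (a δ) hexCriticalFugacity (5 / 8) (b δ)‖ ≤ M := by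
    intro ψ hψc hψK hψD
    have h1 := hT D ρ' Λ m' a b Φ L Lb ψ hρ' hflat hadm hexh ha hb hΦ hΦb hL hexpL hLb hψc hψK hψD
    exact ⟨‖c * ∫ z, ψ z * Complex.exp ((5 / 8 : ℂ) * (L z - Lb))‖ + 1,
      h1.norm.eventually_le_const (lt_add_one _)⟩
  -- (4) the normaliser is eventually non-zero (winding rigidity at the boundary normaliser)
  have hne : ∀ᶠ δ : ℝ in 𝓝[>] 0,
      hexParafermionicObservable (Λ δ) (a δ) hexCriticalFugacity (5 / 8) (b δ) ≠ 0 :=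
    (eventually_normaliser_ne_zero_of_bundles hadm1 hadm0).mono fun _ h => h.1
  -- (5) Banach–Steinhaus
  exact localL1Bound_of_eventually_bounded Λ a b D.isOpen hne hN hK hKU

end Summit.CriticalPhenomena.SAWScalingLimit.Theorems.PickHalfPlane.LocalL1

end
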